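import Summits.QuantumFields.YangMills.Theorems.LuscherReductionTwistedTraceScalingBOSliceCoreIndicators
import Summits.QuantumFields.YangMills.Theorems.LuscherReductionTwistedTraceScalingBOCentralRelLink
import Summits.QuantumFields.YangMills.Theorems.LuscherReductionTwistedTraceScalingGaugeActionRelLinkVec
import Summits.QuantumFields.YangMills.Theorems.TwistedTraceScaling.Negative.CentralGlueCoSupport
import HarnessLib

/-!
# (C1c'-ν) STEP (5): OFF THE FADDEEV–POPOV CORE THE BO FUNCTION VANISHES along the orbit of a slice tube point that is gauge-close to the slice — the core-complement part of the
# localised average is EXACTLY zero, no Gaussian tail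
# (lane A of S-BASE, crux `TwistedTraceScaling` stmt-QuantumFields-20203, C4-CORE, the (OD) pen; item (5) of `pub/ym-fleet/ym-luscher-20007-p1/COARSE-DESIGN.md` §28.5)

The lower half of (C1c') (`…BOGaugeAvgSlice.localisedAvg_orbit_bounds`) carries the term `∫𝟙_{coreSetᶜ}(g)·f(V^{g⁻¹})dg` (`f` the BO function of record, `coreSet R₁'` the jump core of the
Faddeev–Popov weight).  For `V = c₀·(tubePt p)^{P∘ξ'}` substitute `g = c₀h'k`: `f(k⁻¹U*) ≠ 0` puts `k⁻¹U*` in the fat tube with `‖relLinkVec‖ ≤ r`, so `k = d·(P∘ξ'')` with `ξ''` based and —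
by COERCIVITY of the slice map along the orbit (`‖ξ‖ ≤ 4C_L‖P_Γ basedLin p ξ‖`, Taylor, `P_Γ x* = 0`) — `‖ξ''‖ ≤ 8C_L·r`; likewise `‖ξ'‖ ≤ 8C_L·‖P_Γ relLinkVec V‖`.  Every jump of `g` is then
`≤ 2(‖ξ'‖∞ + ‖ξ''‖∞)·2 ≤ 32C_L(‖P_Γ relLinkVec V‖ + r) < R₁'`, i.e. `g ∈ coreSet R₁'`: the integrand vanishes identically.
* §1 quaternion bookkeeping: `mulConst_mem_coreSet_iff`, `norm_su2Quat_mul_inv_sub_one_le` (with `…Negative.R45.norm_su2Quat_inv_sub_one`), `norm_su2Quat_chartSU2_sub_one_le` (`‖q(P v) − 1‖ ≤ 2‖v‖∞`);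
* §2 ★ `starProjection_constMode_eq_zero` (constant modes ⊥ gauge modes: telescoping on the torus), ★ `norm_proj_chartVec_sub_relLinkVec_le` (`‖P_Γ(chartVec w − relLinkVec(P w))‖ ≤ 14|E|ρ²`
  — the `O(ρ)` constant mode of `…BOCentralRelLink.relLinkVec_chart_decomposition` is invisible to `P_Γ`);
* §3 ★ `coercive_bootstrap` (`‖ξ‖ ≤ a`, `4C_LM_Ta ≤ 1/2` ⇒ `‖ξ‖ ≤ 8C_L‖P_Γ basedFn(ξ,p)‖`);
* §4 ★★★ `coreComplement_eq_zero` / ★★★ `integral_coreComplement_eq_zero` — under `32C_L(G_V + r) < R₁'` (`‖P_Γ relLinkVec V‖ ≤ G_V`), `f(V^{g⁻¹}) = 0` off `coreSet R₁'` and the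
  core-complement integral is `0`.
Schedule B: `G_V ≤ ‖P_Γ x'‖ + R₀ + 14|E|ρ² = O(β^{-1/2}·btLog)`, `r = r_f = O(β^{-1/2}·btLog)`, `R₁' = 5β^{-1/2}ℓ²`, `ℓ² ≫ btLog`: the condition holds eventually for EVERY fibre point of `supp Ω`
— the Faddeev–Popov core does not restrict the inner core at all (only (C1d)'s tail radius does).
HONEST FRAMING: support geometry for a stub of a child of the CONDITIONAL route R2b1; (C1c') assembly/rates, (C4), (C5), (B-ST) OPEN; C4-CORE OPEN; not infinite volume, not a gap, not Clay.
-/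

set_option autoImplicit false

noncomputable section

open MeasureTheory Real
open scoped BigOperators RealInnerProductSpace Matrix Quaternion
open Literature.MathematicalPhysics.QuantumFieldTheory
open Literature.MathematicalPhysics.QuantumLattice

namespace Summit.QuantumFields.YangMills.Theorems.FemtoTransferGap.TwoLattice.ConstTube

open Summit.QuantumFields.YangMills.Theorems.FemtoTransferGap
open Summit.QuantumFields.YangMills.Theorems.FemtoTransferGap.TwoLattice
open Summit.QuantumFields.YangMills.Theorems.FemtoTransferGap.TwoLattice.Avg
open Summit.QuantumFields.YangMills.Theorems.FemtoTransferGap.TwoLattice.Stiff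
open Summit.QuantumFields.YangMills.Theorems.FemtoTransferGap.TwoLattice.GnChart
open Literature.MathematicalPhysics.QuantumFieldTheory.Balaban1983to89.T4CubeChartGnomonic (gnoPoint)

variable {L : ℕ} [NeZero L]

/-! ## §1 Quaternion bookkeeping: jumps of products, the core under right translation -/

omit [NeZero L] in
/-- The core is invariant under right multiplication by a constant: `(x ↦ g_x c) ∈ coreSet R₁ ↔ g ∈ coreSet R₁`. [folklore] -/
theorem mulConst_mem_coreSet_iff (R₁ : ℝ) (c : SU2) (g : Site 3 L → SU2) : (fun x => g x * c) ∈ coreSet L R₁ ↔ g ∈ coreSet L R₁ := by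
  have key : ∀ x y : Site 3 L, ‖su2Quat (g x * c) - su2Quat (g y * c)‖ = ‖su2Quat (g x) - su2Quat (g y)‖ := fun x y => by
    rw [su2Quat_mul, su2Quat_mul, ← sub_mul, norm_mul, norm_su2Quat, mul_one]
  simp only [coreSet, Set.mem_setOf_eq, key]

/-- `‖q(AB⁻¹) − 1‖ ≤ ‖q(A) − 1‖ + ‖q(B) − 1‖`. [folklore] -/
theorem norm_su2Quat_mul_inv_sub_one_le (A B : SU2) : ‖su2Quat (A * B⁻¹) - 1‖ ≤ ‖su2Quat A - 1‖ + ‖su2Quat B - 1‖ := by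
  have h : su2Quat (A * B⁻¹) - 1 = (su2Quat A - 1) * su2Quat B⁻¹ + (su2Quat B⁻¹ - 1) := by rw [su2Quat_mul, sub_mul, one_mul]; abel
  rw [h]
  calc _ ≤ ‖(su2Quat A - 1) * su2Quat B⁻¹‖ + ‖su2Quat B⁻¹ - 1‖ := norm_add_le _ _
    _ = ‖su2Quat A - 1‖ + ‖su2Quat B - 1‖ := by rw [norm_mul, norm_su2Quat, mul_one, TwistedTraceScaling.Negative.R45.norm_su2Quat_inv_sub_one]

omit [NeZero L] in
/-- `‖q(chartSU2 v) − 1‖ ≤ 2‖v‖∞` for `‖v‖∞ ≤ 1/3`. [folklore] -/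
theorem norm_su2Quat_chartSU2_sub_one_le {v : Fin 3 → ℝ} {a : ℝ} (hv : ‖v‖ ≤ a) (ha : a ≤ 1 / 3) : ‖su2Quat (chartSU2 v) - 1‖ ≤ 2 * a := by
  have ha0 : 0 ≤ a := (norm_nonneg _).trans hv
  have hsum : ∑ c, v c ^ 2 ≤ 3 * a ^ 2 := by
    have h : ∀ c, v c ^ 2 ≤ a ^ 2 := fun c => by
      have h1 : |v c| ≤ a := by have := norm_le_pi_norm v c; rw [Real.norm_eq_abs] at this; exact this.trans hv
      rw [← sq_abs]; exact pow_le_pow_left₀ (abs_nonneg _) h1 2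
    calc ∑ c, v c ^ 2 ≤ ∑ _c : Fin 3, a ^ 2 := Finset.sum_le_sum fun c _ => h c
      _ = 3 * a ^ 2 := by simp
  have hsum0 : 0 ≤ ∑ c, v c ^ 2 := Finset.sum_nonneg fun c _ => sq_nonneg _
  have hsum1 : ∑ c, v c ^ 2 ≤ 1 := hsum.trans (by nlinarith)
  have hsq : ‖su2Quat (chartSU2 v) - 1‖ ^ 2 ≤ (2 * a) ^ 2 := by
    rw [norm_su2Quat_sub_one_sq, scalarPart_chartSU2 hsum1, vecPart_chartSU2 hsum1]
    set S := ∑ c, v c ^ 2 with hS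
    have h1 : 1 - S ≤ Real.sqrt (1 - S) := by
      have h := Real.sqrt_le_sqrt (by nlinarith : (1 - S) ^ 2 ≤ 1 - S)
      rwa [Real.sqrt_sq (by linarith)] at h
    have h2 : Real.sqrt (1 - S) ≤ 1 := by
      calc Real.sqrt (1 - S) ≤ Real.sqrt 1 := Real.sqrt_le_sqrt (by linarith)
        _ = 1 := Real.sqrt_one
    have h3 : (Real.sqrt (1 - S) - 1) ^ 2 ≤ S ^ 2 := by nlinarith
    have h4 : S ^ 2 ≤ (3 * a ^ 2) ^ 2 := pow_le_pow_left₀ hsum0 hsum 2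
    have h5 : 9 * a ^ 2 ≤ 1 := by nlinarith
    have h6 : (3 * a ^ 2) ^ 2 ≤ a ^ 2 := by nlinarith [sq_nonneg a]
    nlinarith
  exact (pow_le_pow_iff_left₀ (norm_nonneg _) (by positivity) two_ne_zero).1 hsq

/-! ## §2 The gauge-mode projection: constant modes are invisible, the chart discrepancy is `O(ρ²)` -/

/-- ★ **Constant modes are orthogonal to the gauge modes**: `P_Γ κ̄ = 0` for `κ̄(e,a) = c_{dir e, a}` (telescoping `Σ_x (φ(x+k̂) − φ(x)) = 0` on the torus). [folklore] -/
theorem starProjection_constMode_eq_zero (c : Fin 3 → Fin 3 → ℝ) :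
    (gaugeModes L).starProjection (WithLp.toLp 2 fun ea : Edge 3 L × Fin 3 => c ea.1.2 ea.2 : LinkSpace L) = 0 := by
  rw [Submodule.starProjection_apply_eq_zero_iff, Submodule.mem_orthogonal]
  rintro u ⟨φ, rfl⟩
  rw [PiLp.inner_apply]
  simp only [vacGrad, LinearMap.coe_mk, AddHom.coe_mk]
  simp only [RCLike.inner_apply, conj_trivial]
  rw [Fintype.sum_prod_type, Fintype.sum_prod_type]
  -- `Σ_x Σ_k Σ_a (φ(x+k̂)_a − φ(x)_a)·c_{k,a}`: swap the site sum inside and telescope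
  rw [Finset.sum_comm]
  refine Finset.sum_eq_zero fun k _ => ?_
  rw [Finset.sum_comm]
  refine Finset.sum_eq_zero fun a _ => ?_
  have h := sum_shift_eq (L := L) (fun x => φ x a) k
  simp only [mul_sub, Finset.sum_sub_distrib, ← Finset.mul_sum, h, sub_self]

/-- ★ **The gauge component of the chart discrepancy is `O(ρ²)`**: `‖P_Γ(chartVec w − relLinkVec (P w))‖ ≤ 14|E|ρ²` on the chart ball `Σ_a w_e a² ≤ ρ²` (`0 ≤ ρ ≤ 1/5`): the constant mode
(`O(ρ)`) is invisible to `P_Γ`, the remainder is `≤ 7ρ²` per component (`…BOCentralRelLink.relLinkVec_chart_decomposition`). [folklore] -/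
theorem norm_proj_chartVec_sub_relLinkVec_le {ρ : ℝ} (hρ0 : 0 ≤ ρ) (hρ5 : ρ ≤ 1 / 5) {w : Edge 3 L → Fin 3 → ℝ} (hw : ∀ e, ∑ a, w e a ^ 2 ≤ ρ ^ 2) :
    ‖(gaugeModes L).starProjection (chartVec w - relLinkVec L (latPatternChart L (fun _ => false) w))‖ ≤ 14 * Fintype.card (Edge 3 L) * ρ ^ 2 := by
  set V := latPatternChart L (fun _ => false) w with hV
  set E : ℝ := (Fintype.card (Edge 3 L) : ℝ) with hE
  have hE1 : 1 ≤ E := by rw [hE]; exact_mod_cast Fintype.card_pos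
  set κ : LinkSpace L := WithLp.toLp 2 fun ea : Edge 3 L × Fin 3 => vecPart (polarMean L ea.1.2 V) ea.2 with hκ
  set Rem : LinkSpace L := chartVec w - relLinkVec L V - κ with hRem
  have hsplit : chartVec w - relLinkVec L V = Rem + κ := by rw [hRem]; abel
  have hPκ : (gaugeModes L).starProjection κ = 0 := starProjection_constMode_eq_zero (L := L) (fun k a => vecPart (polarMean L k V) a)
  rw [hsplit, map_add, hPκ, add_zero]
  refine (Submodule.norm_starProjection_apply_le _ _).trans ?_
  have hcomp : ∀ ea : Edge 3 L × Fin 3, |Rem ea| ≤ 7 * ρ ^ 2 := fun ea => by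
    obtain ⟨e, a⟩ := ea
    exact relLinkVec_chart_decomposition hρ0 hρ5 hw e a
  have hsq : ‖Rem‖ ^ 2 ≤ 3 * E * (7 * ρ ^ 2) ^ 2 := by
    rw [EuclideanSpace.norm_sq_eq]
    calc ∑ ea, ‖Rem ea‖ ^ 2 ≤ ∑ _ea : Edge 3 L × Fin 3, (7 * ρ ^ 2) ^ 2 := Finset.sum_le_sum fun ea _ => by
          rw [Real.norm_eq_abs]; exact pow_le_pow_left₀ (abs_nonneg _) (hcomp ea) 2
      _ = 3 * E * (7 * ρ ^ 2) ^ 2 := by rw [Finset.sum_const, Finset.card_univ, Fintype.card_prod, Fintype.card_fin, nsmul_eq_mul]; push_cast; rw [hE]; ring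
  have hsq' : ‖Rem‖ ^ 2 ≤ (14 * E * ρ ^ 2) ^ 2 := by
    calc ‖Rem‖ ^ 2 ≤ 3 * E * (7 * ρ ^ 2) ^ 2 := hsq
      _ ≤ (14 * E * ρ ^ 2) ^ 2 := by nlinarith [sq_nonneg (ρ ^ 2), sq_nonneg E]
  exact (pow_le_pow_iff_left₀ (norm_nonneg _) (by positivity) two_ne_zero).1 hsq'

/-! ## §3 The coercive bootstrap along a based orbit -/

/-- ★ **Coercive bootstrap**: at a slice base point `p` (`P_Γ(linkEmbed p.1) = 0`, `‖p‖ < ε_T, ε_C`, `‖p‖ ≤ 1/40`), a based parameter `ξ` with the a-priori bound `‖ξ‖ ≤ a < ε_T` and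
`4C_L·M_T·a ≤ 1/2` satisfies `‖ξ‖ ≤ 8C_L·‖P_Γ basedFn(ξ, p)‖` (coercivity `hC`, Taylor `hT`, `‖P_Γ y‖ ≤ ‖y‖`). [folklore] -/
theorem coercive_bootstrap (p : balancedSubmodule L × (Fin 3 → Fin 3 → ℝ))
    {εT MT : ℝ} (hMT : 0 ≤ MT)
    (hT : ∀ (ξ : basedSubmodule L) (q : balancedSubmodule L × (Fin 3 → Fin 3 → ℝ)), ‖ξ‖ < εT → ‖q‖ < εT →
      ‖basedFn L (ξ, q) - basedFn L (0, q) - basedLin L q ξ‖ ≤ MT * ‖ξ‖ ^ 2)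
    {εC : ℝ} (hC : ∀ q : balancedSubmodule L × (Fin 3 → Fin 3 → ℝ), ‖q‖ < εC →
      ∀ ξ : basedSubmodule L, ‖ξ‖ ≤ 4 * sliceConst L * ‖(gaugeModes L).starProjection (basedLin L q ξ)‖)
    (hpT : ‖p‖ < εT) (hpC : ‖p‖ < εC) (hp40 : ‖p‖ ≤ 1 / 40)
    (hslice : (gaugeModes L).starProjection (linkEmbed L (p.1 : Edge 3 L → Fin 3 → ℝ)) = 0)
    {ξ : basedSubmodule L} {a : ℝ} (hξa : ‖ξ‖ ≤ a) (haT : a < εT) (hboot : 4 * sliceConst L * MT * a ≤ 1 / 2) :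
    ‖ξ‖ ≤ 8 * sliceConst L * ‖(gaugeModes L).starProjection (basedFn L (ξ, p))‖ := by
  have hCpos := sliceConst_pos L
  have hp1 : ‖p.1‖ ≤ 1 / 20 := (norm_fst_le p).trans (by linarith)
  have hp2 : ‖p.2‖ ≤ 1 / 40 := (norm_snd_le p).trans hp40
  have hfB0 : basedFn L (0, p) = linkEmbed L (p.1 : Edge 3 L → Fin 3 → ℝ) := basedFn_zero_left L p hp1 hp2
  have hξT : ‖ξ‖ < εT := lt_of_le_of_lt hξa haT
  set P := (gaugeModes L).starProjection with hP
  set Err : LinkSpace L := basedFn L (ξ, p) - basedFn L (0, p) - basedLin L p ξ with hErr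
  have hErr_le : ‖Err‖ ≤ MT * ‖ξ‖ ^ 2 := hT ξ p hξT hpT
  -- `P(basedLin p ξ) = P(basedFn(ξ,p)) − P(Err)` since `P(basedFn(0,p)) = P(x*) = 0`
  have hlin : P (basedLin L p ξ) = P (basedFn L (ξ, p)) - P Err := by
    have e : basedLin L p ξ = basedFn L (ξ, p) - basedFn L (0, p) - Err := by rw [hErr]; abel
    rw [e, map_sub, map_sub, hfB0, hslice, sub_zero]
  have hco := hC p hpC ξ
  have hPErr : ‖P Err‖ ≤ MT * ‖ξ‖ ^ 2 := (Submodule.norm_starProjection_apply_le _ _).trans hErr_le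
  have h1 : ‖P (basedLin L p ξ)‖ ≤ ‖P (basedFn L (ξ, p))‖ + MT * ‖ξ‖ ^ 2 := by
    rw [hlin]; exact (norm_sub_le _ _).trans (by linarith)
  have ha0 : 0 ≤ a := (norm_nonneg _).trans hξa
  -- `‖ξ‖ ≤ 4C(‖P fB‖ + M‖ξ‖²) ≤ 4C‖P fB‖ + (4CMa)‖ξ‖ ≤ 4C‖P fB‖ + ‖ξ‖/2`
  have h2 : MT * ‖ξ‖ ^ 2 ≤ MT * a * ‖ξ‖ := by
    have := mul_le_mul_of_nonneg_left (mul_le_mul_of_nonneg_right hξa (norm_nonneg ξ)) hMT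
    calc MT * ‖ξ‖ ^ 2 = MT * (‖ξ‖ * ‖ξ‖) := by ring
      _ ≤ MT * (a * ‖ξ‖) := this
      _ = MT * a * ‖ξ‖ := by ring
  have h3 : ‖ξ‖ ≤ 4 * sliceConst L * ‖P (basedFn L (ξ, p))‖ + (4 * sliceConst L * MT * a) * ‖ξ‖ := by
    calc ‖ξ‖ ≤ 4 * sliceConst L * ‖P (basedLin L p ξ)‖ := hco
      _ ≤ 4 * sliceConst L * (‖P (basedFn L (ξ, p))‖ + MT * a * ‖ξ‖) := by gcongr; linarith
      _ = _ := by ring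
  have h4 : (4 * sliceConst L * MT * a) * ‖ξ‖ ≤ (1 / 2) * ‖ξ‖ := mul_le_mul_of_nonneg_right hboot (norm_nonneg _)
  linarith

/-! ## §4 ★★★ The core-complement part vanishes -/

/-- ★★★ **STEP (5): OFF THE FADDEEV–POPOV CORE THE BO FUNCTION VANISHES ALONG THE ORBIT.**  Let `V = c₀·(tubePt p)^{P∘ξ'}` with `p` a slice base point (`‖p‖ < ε_T, ε_C`, `‖p‖ ≤ 1/40`,
`tubePt p ∈ nearOne ρ₁`), `ξ'` based with `‖ξ'‖ ≤ a' < ε_T`, `a' ≤ 1/3`, `4C_LM_Ta' ≤ 1/2`, and `‖P_Γ relLinkVec V‖ ≤ G_V`.  Let `f` be any function whose support lies in the fat tube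
`fatTubeRho δ ρ_f β` with `‖relLinkVec‖ ≤ r` there (the BO function of record), and let the based radius `R_b = 3(L−1)(ρ₁ + ρ_f β)` satisfy `R_b ≤ 1/3`, `R_b < ε_T`, `4C_LM_TR_b ≤ 1/2`.
If `32C_L(G_V + r) < R₁'` then `f(V^{g⁻¹}) = 0` for every `g ∉ coreSet R₁'`: the orbit points of `V` in `supp f` are reached only by gauge transformations with all jumps `< R₁'`
(coercivity of the slice map along the orbit: `‖ξ‖ ≤ 8C_L‖P_Γ basedFn(ξ,p)‖`). [cite: Luscher1983, §3] -/
theorem coreComplement_eq_zero (p : balancedSubmodule L × (Fin 3 → Fin 3 → ℝ))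
    {εT MT : ℝ} (hMT : 0 ≤ MT)
    (hT : ∀ (ξ : basedSubmodule L) (q : balancedSubmodule L × (Fin 3 → Fin 3 → ℝ)), ‖ξ‖ < εT → ‖q‖ < εT →
      ‖basedFn L (ξ, q) - basedFn L (0, q) - basedLin L q ξ‖ ≤ MT * ‖ξ‖ ^ 2)
    {εC : ℝ} (hC : ∀ q : balancedSubmodule L × (Fin 3 → Fin 3 → ℝ), ‖q‖ < εC →
      ∀ ξ : basedSubmodule L, ‖ξ‖ ≤ 4 * sliceConst L * ‖(gaugeModes L).starProjection (basedLin L q ξ)‖)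
    (hpT : ‖p‖ < εT) (hpC : ‖p‖ < εC) (hp40 : ‖p‖ ≤ 1 / 40)
    (hslice : (gaugeModes L).starProjection (linkEmbed L (p.1 : Edge 3 L → Fin 3 → ℝ)) = 0)
    {ρ₁ : ℝ} (hU1 : tubePt L p ∈ nearOne L ρ₁)
    -- the orbit point
    {V : GaugeConfig 3 L SU2} {c₀ : SU2} {ξ' : basedSubmodule L}
    (hrep : V = gaugeTransform (fun _ : Site 3 L => c₀) (gaugeTransform (fun x => chartSU2 ((ξ' : Site 3 L → Fin 3 → ℝ) x)) (tubePt L p)))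
    {a' : ℝ} (hξ'a : ‖ξ'‖ ≤ a') (ha'T : a' < εT) (ha'3 : a' ≤ 1 / 3) (hboot' : 4 * sliceConst L * MT * a' ≤ 1 / 2)
    {GV : ℝ} (hGV : ‖(gaugeModes L).starProjection (relLinkVec L V)‖ ≤ GV)
    -- the function: supported in the fat tube with `‖relLinkVec‖ ≤ r`
    {f : GaugeConfig 3 L SU2 → ℝ} {δ ρf : ℝ → ℝ} {β r : ℝ} (hf : ∀ U, f U ≠ 0 → U ∈ fatTubeRho L δ ρf β ∧ ‖relLinkVec L U‖ ≤ r)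
    -- the based radius
    (hRb3 : 3 * ((L : ℝ) - 1) * (ρ₁ + ρf β) ≤ 1 / 3) (hRbT : 3 * ((L : ℝ) - 1) * (ρ₁ + ρf β) < εT) (hbootb : 4 * sliceConst L * MT * (3 * ((L : ℝ) - 1) * (ρ₁ + ρf β)) ≤ 1 / 2)
    {R₁' : ℝ} (hR : 32 * sliceConst L * (GV + r) < R₁') {g : Site 3 L → SU2} (hg : g ∉ coreSet L R₁') :
    f (gaugeTransform g⁻¹ V) = 0 := by
  by_contra hne
  have hCpos := sliceConst_pos L
  set h'f : Site 3 L → SU2 := fun x => chartSU2 ((ξ' : Site 3 L → Fin 3 → ℝ) x) with hh'f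
  set Us := tubePt L p with hUs
  set U := gaugeTransform g⁻¹ V with hUdef
  -- `U = γ · U*`, `γ = g⁻¹ c₀ h'`
  set γ : Site 3 L → SU2 := g⁻¹ * ((fun _ => c₀) * h'f) with hγ
  have hUγ : U = gaugeTransform γ Us := by
    rw [hUdef, hrep, gaugeTransform_gaugeTransform, gaugeTransform_gaugeTransform, hγ, mul_assoc]
  obtain ⟨hUfat, hUrel⟩ := hf U hne
  -- the based part of `γ`
  set d : SU2 := γ 0 with hd
  set γb : Site 3 L → SU2 := fun x => d⁻¹ * γ x with hγb
  have hγb0 : γb 0 = 1 := by simp [hγb, hd]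
  have hγsplit : γ = (fun _ => d) * γb := by funext x; simp [hγb]
  set W := gaugeTransform γb Us with hW
  have hUW : U = gaugeTransform (fun _ : Site 3 L => d) W := by rw [hUγ, hγsplit, ← gaugeTransform_gaugeTransform]
  have hWfat : W ∈ fatTubeRho L δ ρf β := by
    have h1 : W = gaugeTransform (fun _ : Site 3 L => d⁻¹) U := by
      rw [hUW, gaugeTransform_gaugeTransform]
      have : ((fun _ : Site 3 L => d⁻¹) * fun _ => d) = (1 : Site 3 L → SU2) := by funext x; simp
      rw [this, TT.gaugeTransform_one']
    rw [h1]; exact (conj_mem_fatTubeRho_iff L d⁻¹ δ ρf β U).2 hUfat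
  have hWnear : W ∈ nearOne L (ρf β) := hWfat.1
  -- every `γb x` is within `R_b` of `1`
  set Rb : ℝ := 3 * ((L : ℝ) - 1) * (ρ₁ + ρf β) with hRb
  have hγbR : ∀ x, frobNorm (((γb x : SU2) : Matrix (Fin 2) (Fin 2) ℂ) - 1) ≤ Rb := fun x => frobNorm_sub_one_le_of_based L hU1 (by rw [← hW]; exact hWnear) hγb0 x
  -- `γb = basedExt (gno ∘ w'') = P ∘ ξ''`
  set hb : NzSite L → SU2 := fun y => γb y.1 with hhb
  have hγbExt : basedExt L hb = γb := by
    funext x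
    by_cases hx : x = 0
    · subst hx; rw [basedExt_zero, hγb0]
    · rw [basedExt_of_ne L _ hx]
  set w'' : NzSite L → Fin 3 → ℝ := fun y => gnLink (hb y) with hw''
  have hgno : (fun y => gnoPoint (w'' y)) = hb := by
    funext y
    simp only [hw'']
    exact gnoPoint_gnLink (hb y) (scalarPart_pos_of_frobNorm_lt_two (lt_of_le_of_lt (hγbR y.1) (by linarith)))
  set ξ'' : basedSubmodule L := gnoParam L w'' with hξ''
  have hγbP : γb = fun x => chartSU2 ((ξ'' : Site 3 L → Fin 3 → ℝ) x) := by rw [← hγbExt, ← hgno, basedExt_gno_eq]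
  have hWrep : W = gaugeTransform (fun x => chartSU2 ((ξ'' : Site 3 L → Fin 3 → ℝ) x)) Us := by rw [hW, hγbP]
  -- a-priori size of `ξ''`
  have hw''n : ‖w''‖ ≤ Rb := by
    have hWh : gaugeTransform (basedExt L fun y => gnoPoint (w'' y)) Us ∈ nearOne L (ρf β) := by rw [hgno, hγbExt, ← hW]; exact hWnear
    exact norm_le_of_gno_nearOne L hU1 hWh (by linarith)
  have hξ''n : ‖ξ''‖ ≤ Rb := (norm_gnoParam_le L w'').trans hw''n
  -- the gauge components along the orbit
  have hPW : ‖(gaugeModes L).starProjection (basedFn L (ξ'', p))‖ ≤ r := by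
    have e1 : relLinkVec L W = basedFn L (ξ'', p) := by rw [hWrep, hUs, relLinkVec_gaugeTransform_tubePt]
    have e2 : relLinkVec L U = adL L d (relLinkVec L W) := by rw [hUW, relLinkVec_conj]
    have e3 : ‖(gaugeModes L).starProjection (relLinkVec L U)‖ = ‖(gaugeModes L).starProjection (relLinkVec L W)‖ := by
      rw [e2, starProjection_adL, LinearIsometryEquiv.norm_map]
    rw [← e1, ← e3]
    exact (Submodule.norm_starProjection_apply_le _ _).trans hUrel
  have hPV : ‖(gaugeModes L).starProjection (basedFn L (ξ', p))‖ ≤ GV := by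
    have e1 : relLinkVec L V = adL L c₀ (basedFn L (ξ', p)) := by rw [hrep, relLinkVec_conj, hUs, relLinkVec_gaugeTransform_tubePt]
    have e2 : ‖(gaugeModes L).starProjection (relLinkVec L V)‖ = ‖(gaugeModes L).starProjection (basedFn L (ξ', p))‖ := by
      rw [e1, starProjection_adL, LinearIsometryEquiv.norm_map]
    rw [← e2]; exact hGV
  -- coercive bootstrap
  have hξ''b : ‖ξ''‖ ≤ 8 * sliceConst L * r :=
    (coercive_bootstrap (L := L) p hMT hT hC hpT hpC hp40 hslice hξ''n hRbT hbootb).trans (mul_le_mul_of_nonneg_left hPW (by positivity))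
  have hξ'b : ‖ξ'‖ ≤ 8 * sliceConst L * GV :=
    (coercive_bootstrap (L := L) p hMT hT hC hpT hpC hp40 hslice hξ'a ha'T hboot').trans (mul_le_mul_of_nonneg_left hPV (by positivity))
  -- jumps of `g = c₀ · (h' γb⁻¹) · d⁻¹`
  set k : Site 3 L → SU2 := fun x => h'f x * (γb x)⁻¹ with hk
  have hgk : g = fun x => c₀ * k x * d⁻¹ := by
    funext x
    have e1 : γ x = (g x)⁻¹ * (c₀ * h'f x) := by simp [hγ]
    have e2 : γ x = d * γb x := by simp [hγb]
    simp only [hk]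
    have e3 : g x = c₀ * h'f x * (γ x)⁻¹ := by rw [e1]; group
    rw [e3, e2]; group
  have hk1 : ∀ x, ‖su2Quat (k x) - 1‖ ≤ 16 * sliceConst L * (GV + r) := fun x => by
    have e1 := norm_su2Quat_mul_inv_sub_one_le (h'f x) (γb x)
    have e2 : ‖su2Quat (h'f x) - 1‖ ≤ 2 * ‖ξ'‖ :=
      norm_su2Quat_chartSU2_sub_one_le (norm_le_pi_norm (ξ' : Site 3 L → Fin 3 → ℝ) x) (hξ'a.trans ha'3)
    have e3 : ‖su2Quat (γb x) - 1‖ ≤ 2 * ‖ξ''‖ := by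
      rw [hγbP]
      exact norm_su2Quat_chartSU2_sub_one_le (norm_le_pi_norm (ξ'' : Site 3 L → Fin 3 → ℝ) x) (hξ''n.trans hRb3)
    simp only [hk]
    nlinarith [hξ''b, hξ'b, hCpos]
  have hkcore : k ∈ coreSet L R₁' := mem_coreSet_of_forall_norm_sub_one_le (by linarith) hk1
  have hgcore : g ∈ coreSet L R₁' := by
    rw [hgk]
    have h1 : (fun x => c₀ * k x * d⁻¹) = fun x => (fun y => c₀ * k y) x * d⁻¹ := rfl
    rw [h1, mulConst_mem_coreSet_iff, constMul_mem_coreSet_iff]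
    exact hkcore
  exact hg hgcore

/-- ★★★ Consequence: the core-complement part of the localised average vanishes, `∫ 𝟙_{coreSetᶜ}(g)·f(V^{g⁻¹}) dg = 0`. [cite: Luscher1983, §3] -/
theorem integral_coreComplement_eq_zero (p : balancedSubmodule L × (Fin 3 → Fin 3 → ℝ))
    {εT MT : ℝ} (hMT : 0 ≤ MT)
    (hT : ∀ (ξ : basedSubmodule L) (q : balancedSubmodule L × (Fin 3 → Fin 3 → ℝ)), ‖ξ‖ < εT → ‖q‖ < εT →
      ‖basedFn L (ξ, q) - basedFn L (0, q) - basedLin L q ξ‖ ≤ MT * ‖ξ‖ ^ 2)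
    {εC : ℝ} (hC : ∀ q : balancedSubmodule L × (Fin 3 → Fin 3 → ℝ), ‖q‖ < εC →
      ∀ ξ : basedSubmodule L, ‖ξ‖ ≤ 4 * sliceConst L * ‖(gaugeModes L).starProjection (basedLin L q ξ)‖)
    (hpT : ‖p‖ < εT) (hpC : ‖p‖ < εC) (hp40 : ‖p‖ ≤ 1 / 40)
    (hslice : (gaugeModes L).starProjection (linkEmbed L (p.1 : Edge 3 L → Fin 3 → ℝ)) = 0)
    {ρ₁ : ℝ} (hU1 : tubePt L p ∈ nearOne L ρ₁)
    {V : GaugeConfig 3 L SU2} {c₀ : SU2} {ξ' : basedSubmodule L}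
    (hrep : V = gaugeTransform (fun _ : Site 3 L => c₀) (gaugeTransform (fun x => chartSU2 ((ξ' : Site 3 L → Fin 3 → ℝ) x)) (tubePt L p)))
    {a' : ℝ} (hξ'a : ‖ξ'‖ ≤ a') (ha'T : a' < εT) (ha'3 : a' ≤ 1 / 3) (hboot' : 4 * sliceConst L * MT * a' ≤ 1 / 2)
    {GV : ℝ} (hGV : ‖(gaugeModes L).starProjection (relLinkVec L V)‖ ≤ GV)
    {f : GaugeConfig 3 L SU2 → ℝ} {δ ρf : ℝ → ℝ} {β r : ℝ} (hf : ∀ U, f U ≠ 0 → U ∈ fatTubeRho L δ ρf β ∧ ‖relLinkVec L U‖ ≤ r)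
    (hRb3 : 3 * ((L : ℝ) - 1) * (ρ₁ + ρf β) ≤ 1 / 3) (hRbT : 3 * ((L : ℝ) - 1) * (ρ₁ + ρf β) < εT) (hbootb : 4 * sliceConst L * MT * (3 * ((L : ℝ) - 1) * (ρ₁ + ρf β)) ≤ 1 / 2)
    {R₁' : ℝ} (hR : 32 * sliceConst L * (GV + r) < R₁') :
    ∫ g, (coreSet L R₁')ᶜ.indicator (fun g => f (gaugeTransform g⁻¹ V)) g ∂gaugeMeasure L = 0 := by
  have hzero : (fun g => (coreSet L R₁')ᶜ.indicator (fun g => f (gaugeTransform g⁻¹ V)) g) = fun _ => 0 := by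
    funext g
    by_cases hg : g ∈ coreSet L R₁'
    · exact Set.indicator_of_notMem (Set.notMem_compl_iff.2 hg) _
    · rw [Set.indicator_of_mem (Set.mem_compl hg)]
      exact coreComplement_eq_zero (L := L) p hMT hT hC hpT hpC hp40 hslice hU1 hrep hξ'a ha'T ha'3 hboot' hGV hf hRb3 hRbT hbootb hR hg
  rw [hzero, integral_zero]

end Summit.QuantumFields.YangMills.Theorems.FemtoTransferGap.TwoLattice.ConstTube

end
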